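import Literature.Probability.RandomPlanarGeometry.HexSAWRotStripLogDecay
import Mathlib.Analysis.Complex.ExponentialBounds
import HarnessLib

/-!
# Explicit constants for the logarithmic decay of Beaton's rotated-strip bridge generating function

Topic `Literature/Probability/RandomPlanarGeometry`; lane «pcv-sawmu», door «ROT-LOGDECAY-EXPLICIT» (planner a-idea-1,
gen 24; technique lens: bridge decompositions with EXPLICIT rates — which structural statements become provable with an
explicit rate once a finite-data-certified inequality is in hand).

Sources: A. Glazman, I. Manolescu, *Self-avoiding walk on ℤ² with Yang–Baxter weights: universality of critical
fugacity and 2-point function*, Ann. Inst. Henri Poincaré Probab. Stat. 56 (2020) (arXiv:1708.00395v3), §4.1, Lemma 4.1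
and the proof of Proposition 1.1 (pp. 13–14: the three rotated triangles, the concatenation inequality, and the
bookkeeping "`Σ_k (D_{4·9^k})³ ≤ 8 Σ_k G(0,k) < ∞` with `D` decreasing" — in print concluded only ALONG A SUBSEQUENCE
(Proposition 1.1: «`B_T < (log T)^{-1/3}` for infinitely many values of `T`»); the all-`T` form `D_T ≤ C (log T)^{-1/3}` is the
TREE's (`HexSAWBridgeLogDecay`, `RotGM.logRate_of_blocks`; token RL-2, ref g44 §77.3)); N. R. Beaton, *The critical surface
fugacity of self-avoiding walks on a rotated honeycomb lattice*, J. Phys. A 47 (2014) 075003 (arXiv:1210.0274v3), §2.2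
Proposition 4 (the strip identity and its coefficients), §4 and Appendix Theorem 14 (`B_T(x_c) → 0`, no rate).

WHAT THE TREE HAS. `HexSAWRotTourKeyIneq`: K95.4 `rotTriBlockIneq_holds : ∃ A ≥ 0, ∀ m, (m+1)·W_{4·20^m}³ ≤ A` — the
constant `A = (K/2)/c_I · (2c_B)³/x_c²` is computed INSIDE the proof of `rotTriBlockIneq_of_tour` but the statement is
existential; `HexSAWRotStripLogDecay`: THM A `rotStripLogDecay_holds : ∃ C, ∀ H ≥ 2, ∀ W, B^{⊥,→}_{D(H,W)}(x_c) ≤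
C (log H)^{-1/3}`, `iSup_rotStripBR_le_log` (the same for `B_H(x_c) = ⨆_W`), `HexBW.spanDecayLog_holds : ∃ C, ∀ A ≥ 2,
v_A ≤ C (log A)^{-1/3}` — all with an anonymous constant.

WHAT THIS FILE ADDS (11 public theorems; every constant a closed form AND a numeral; no new definitions):
* **T1** `rotTriBlockIneq_explicit`: `(m+1) · W_{4·20^m}³ ≤ A₀ := 2x_c cos(π/16)/(2 sin(π/16)) · (4cos(π/16))³/x_c²`
  for every `m` (the tree's derivation run on the tree's tour `rotTourKeyIneq_holds`, constant exposed);
  `rotTriBlockConst_eq : A₀ = 64 cos⁴(π/16)/(x_c sin(π/16))`, `rotTriBlockConst_le : A₀ ≤ 562`, hence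
  `rotTriBlockIneq_numeral : (m+1) · W_{4·20^m}³ ≤ 562`.
* **T2** `rotTriW_le_log_explicit`: `W_N ≤ max(2x_c cos(π/16) · (log 6400)^{1/3}, (2 A₀ log 20)^{1/3}) · (log N)^{-1/3}`
  (`N ≥ 2`; the tree's abstract tail `SAW.antitone_le_log_rpow_of_blocks` with `a = 4, b = 0, q = 20`), and the numeral
  form `rotTriW_le_fifteen_mul_log : W_N ≤ 15 · (log N)^{-1/3}`.
* **T3** `rotStripBR_le_twentyone_mul_log : ∀ H ≥ 2, ∀ W, B^{⊥,→}_{D(H,W)}(x_c) ≤ 21 · (log H)^{-1/3}` and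
  `iSup_rotStripBR_le_twentyone_mul_log : B_H(x_c) ≤ 21 · (log H)^{-1/3}` — THM A with an explicit constant
  (`H < 64` by Beaton's uniform bound `≤ 2x_c cos(π/16) ≤ 1.0617`; `H ≥ 64` through `M = ⌊(H−2)/6⌋`, `log M ≥ ½ log H`,
  `15 · 2^{1/3} ≤ 18.9`).
* **T4** `HexBW.bwSpanV_le_thirtynine_mul_log : ∀ A ≥ 2, v_A = Σ_m #spanBridges(m, A) μ^{-m} ≤ 39 · (log A)^{-1/3}` —
  the brick-wall span generating functions of Beaton's Appendix (his Theorem 14 prints `→ 0`) with an explicit constant,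
  via the tree's dictionary `HexBW.rot_dictionary` (`x_c⁻¹ · 21 ≤ 39`).
* numerals used (private): `0.54119 < x_c < 0.5412`, `cos(π/16) < 0.98079`, `0.195 < sin(π/16)`, `log 20 ≤ 3`,
  `log 6400 ≤ 9`, `log 64 ≤ 4.16`, and `y^{1/3} ≤ c` from `y ≤ c³`.

HONEST LABEL. Consolidation with explicit constants: the mechanism (Glazman–Manolescu's three-triangle tour transported
to Beaton's frame) is the tree's door R95; this file only makes its constants explicit and certified.  The numerals are
not sharp (`A₀ = 560.9…`, and `(log H)^{-1/3}` decay with constant 21 is numerically weak: the bound beats Beaton's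
uniform `1.06` only for `log H > 7.7·10³`); their point is that every constant downstream (e.g. threshold-locality rates
`y_{H+1} − y† ≤ K · B_H(x_c)`) becomes a numeral.  Parallel frame, for comparison (NOT used): Krachun–Panagiotis 2026
Thm 2 `B_T ≤ 100 · T^{-10^{-10}}` (a power law by a different method, recorded in the tree's `KPRecurrenceDecay`), and the
tree THEOREM `HV.hexBridgeLogDecay : HexBridgeLogDecay 5 2` (`B_T(x_c) ≤ 5 (ln T)^{-1/3}`, `HexSAWBridgeLogDecay`), of which
T3 is the rotated-frame twin with the rotated frame's constants.
-/

noncomputable section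

open Finset Filter Topology
open scoped BigOperators

namespace Literature.Probability.RandomPlanarGeometry.SAW

namespace HV

/-! ## §0 Certified numerals -/

/-- `cos(π/16) > 0`. [folklore] -/
private theorem cos16_pos : 0 < Real.cos (Real.pi / 16) := by
  apply Real.cos_pos_of_mem_Ioo; constructor <;> linarith [Real.pi_pos]

/-- `sin(π/16) > 0`. [folklore] -/
private theorem sin16_pos : 0 < Real.sin (Real.pi / 16) :=
  Real.sin_pos_of_pos_of_lt_pi (by positivity) (by linarith [Real.pi_pos])

/-- `1.414213 < √2 < 1.414214`. [folklore] -/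
private theorem sqrt2_bounds : (1.414213 : ℝ) < Real.sqrt 2 ∧ Real.sqrt 2 < 1.414214 := by
  constructor
  · rw [show (1.414213 : ℝ) = Real.sqrt (1.414213 ^ 2) by rw [Real.sqrt_sq]; norm_num]
    exact Real.sqrt_lt_sqrt (by norm_num) (by norm_num)
  · rw [show (1.414214 : ℝ) = Real.sqrt (1.414214 ^ 2) by rw [Real.sqrt_sq]; norm_num]
    exact Real.sqrt_lt_sqrt (by norm_num) (by norm_num)

/-- `1.847758 < √(2 + √2) < 1.84776`. [folklore] -/
private theorem sqrt2p_bounds :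
    (1.847758 : ℝ) < Real.sqrt (2 + Real.sqrt 2) ∧ Real.sqrt (2 + Real.sqrt 2) < 1.84776 := by
  obtain ⟨h1, h2⟩ := sqrt2_bounds
  constructor
  · rw [show (1.847758 : ℝ) = Real.sqrt (1.847758 ^ 2) by rw [Real.sqrt_sq]; norm_num]
    exact Real.sqrt_lt_sqrt (by norm_num) (by norm_num; linarith)
  · rw [show (1.84776 : ℝ) = Real.sqrt (1.84776 ^ 2) by rw [Real.sqrt_sq]; norm_num]
    exact Real.sqrt_lt_sqrt (by positivity) (by norm_num; linarith)

/-- `0.54119 < x_c < 0.5412`. [cite: DuminilCopinSmirnov2012, Theorem 1 (μ = √(2+√2))] -/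
private theorem xc_bounds : (0.54119 : ℝ) < hexCriticalFugacity ∧ hexCriticalFugacity < 0.5412 := by
  have hx : 0 < hexCriticalFugacity := hexCriticalFugacity_pos_lt_one.1
  obtain ⟨h1, h2⟩ := sqrt2_bounds
  have hsq := hexCriticalFugacity_sq
  constructor
  · nlinarith [sq_nonneg (hexCriticalFugacity - 0.54119), sq_nonneg (hexCriticalFugacity + 0.54119)]
  · nlinarith [sq_nonneg (hexCriticalFugacity - 0.5412), sq_nonneg (hexCriticalFugacity + 0.5412)]

/-- `cos(π/16) < 0.98079`. [folklore] -/
private theorem cos16_lt : Real.cos (Real.pi / 16) < 0.98079 := by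
  obtain ⟨h3, h4⟩ := sqrt2p_bounds
  rw [Real.cos_pi_div_sixteen,
    show (0.98079 : ℝ) = Real.sqrt (1.96158 ^ 2) / 2 by rw [Real.sqrt_sq]; norm_num; norm_num]
  exact div_lt_div_of_pos_right (Real.sqrt_lt_sqrt (by positivity) (by nlinarith)) two_pos

/-- `0.195 < sin(π/16)`. [folklore] -/
private theorem sin16_gt : (0.195 : ℝ) < Real.sin (Real.pi / 16) := by
  obtain ⟨h3, h4⟩ := sqrt2p_bounds
  rw [Real.sin_pi_div_sixteen,
    show (0.195 : ℝ) = Real.sqrt (0.39 ^ 2) / 2 by rw [Real.sqrt_sq]; norm_num; norm_num]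
  exact div_lt_div_of_pos_right (Real.sqrt_lt_sqrt (by norm_num) (by nlinarith)) two_pos

/-- Beaton's uniform bound constant `K/2 = 2 x_c cos(π/16) ≤ 1.0617`. [cite: Beaton2014RotatedHoneycomb, Proposition 4] -/
private theorem wmax_le : 2 * hexCriticalFugacity * Real.cos (Real.pi / 16) ≤ 1.0617 := by
  have h := mul_le_mul xc_bounds.2.le cos16_lt.le cos16_pos.le (by norm_num)
  nlinarith

/-- `log 20 ≤ 3`. [folklore] -/
private theorem log_twenty_le : Real.log 20 ≤ 3 := by
  rw [Real.log_le_iff_le_exp (by norm_num)]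
  have h3 : Real.exp 3 = Real.exp 1 ^ 3 := by rw [← Real.exp_nat_mul]; norm_num
  rw [h3]
  calc (20 : ℝ) ≤ 2.7182818283 ^ 3 := by norm_num
    _ ≤ Real.exp 1 ^ 3 := pow_le_pow_left₀ (by norm_num) Real.exp_one_gt_d9.le 3

/-- `log 6400 ≤ 9`. [folklore] -/
private theorem log_6400_le : Real.log 6400 ≤ 9 := by
  rw [Real.log_le_iff_le_exp (by norm_num)]
  have h9 : Real.exp 9 = Real.exp 1 ^ 9 := by rw [← Real.exp_nat_mul]; norm_num
  rw [h9]
  calc (6400 : ℝ) ≤ 2.7182818283 ^ 9 := by norm_num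
    _ ≤ Real.exp 1 ^ 9 := pow_le_pow_left₀ (by norm_num) Real.exp_one_gt_d9.le 9

/-- `log 64 ≤ 4.16`. [folklore] -/
private theorem log_64_le : Real.log 64 ≤ 4.16 := by
  rw [show (64 : ℝ) = 2 ^ 6 by norm_num, Real.log_pow]
  push_cast
  linarith [Real.log_two_lt_d9]

/-- cube roots: `0 ≤ y ≤ c³ ⇒ y^{1/3} ≤ c`. [folklore] -/
private theorem rpow_third_le {y c : ℝ} (hy : 0 ≤ y) (hc : 0 ≤ c) (h : y ≤ c ^ 3) :
    y ^ ((1 : ℝ) / 3) ≤ c := by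
  calc y ^ ((1 : ℝ) / 3) ≤ (c ^ 3) ^ ((1 : ℝ) / 3) := Real.rpow_le_rpow hy h (by norm_num)
    _ = c := by
        rw [show ((1 : ℝ) / 3) = ((3 : ℕ) : ℝ)⁻¹ by norm_num]
        exact Real.pow_rpow_inv_natCast hc three_ne_zero

/-! ## §1 (T1) The block inequality with its constant exposed -/

/-- `A₀ ≥ 0`. [cite: GlazmanManolescu2019, §4.1 (proof of Proposition 1.1)] -/
theorem rotTriBlockConst_nonneg :
    0 ≤ 2 * hexCriticalFugacity * Real.cos (Real.pi / 16) / (2 * Real.sin (Real.pi / 16)) *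
        (4 * Real.cos (Real.pi / 16)) ^ 3 / hexCriticalFugacity ^ 2 := by
  have hx : 0 < hexCriticalFugacity := hexCriticalFugacity_pos_lt_one.1
  have hc := cos16_pos
  exact div_nonneg (mul_nonneg (div_nonneg (by positivity) (by linarith [sin16_pos]))
    (pow_nonneg (by linarith) 3)) (pow_nonneg hx.le 2)

/-- **T1 — the BLOCK INEQUALITY for Beaton's rotated triangles WITH ITS CONSTANT**:
`(m+1) · W_{4·20^m}³ ≤ A₀ := 2x_c cos(π/16)/(2 sin(π/16)) · (4cos(π/16))³/x_c²` for every `m` (the tree's K95.4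
`rotTriBlockIneq_holds` is the existential form; the proof is the tree's derivation `rotTriBlockIneq_of_tour` run on the
tree's tour `rotTourKeyIneq_holds`: blocks `20^i`, `i ≤ m`, in one domain `D(28·20^m, 28·20^m)`, `c₂ = c₃ = W/(2c_B)`, total
bottom mass `≤ (K/2)/c_I` by the strip identity).
[cite: GlazmanManolescu2019, Lemma 4.1 and §4.1 (proof of Proposition 1.1, arXiv v3 pp. 13–14); Beaton2014RotatedHoneycomb, Proposition 4] -/
theorem rotTriBlockIneq_explicit (m : ℕ) :
    ((m : ℝ) + 1) * rotTriW (4 * 20 ^ m) ^ 3 ≤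
      2 * hexCriticalFugacity * Real.cos (Real.pi / 16) / (2 * Real.sin (Real.pi / 16)) *
        (4 * Real.cos (Real.pi / 16)) ^ 3 / hexCriticalFugacity ^ 2 := by
  have hx : 0 < hexCriticalFugacity := hexCriticalFugacity_pos_lt_one.1
  have hcB : 0 < Real.cos (Real.pi / 16) := cos16_pos
  have hcB2 : 0 < 4 * Real.cos (Real.pi / 16) := by linarith
  obtain ⟨H, hH⟩ : ∃ H : ℕ, H = 28 * 20 ^ m := ⟨_, rfl⟩
  have hpm : 1 ≤ 20 ^ m := Nat.one_le_pow m 20 (by norm_num)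
  have hH1 : 1 ≤ H := by rw [hH]; omega
  obtain ⟨c, hc⟩ : ∃ c : ℝ, c = rotTriW (4 * 20 ^ m) / (4 * Real.cos (Real.pi / 16)) := ⟨_, rfl⟩
  have hc0 : 0 ≤ c := by rw [hc]; exact div_nonneg (rotTriW_nonneg _) hcB2.le
  -- `c ≤ m_k` for every `k ≤ 4·20^m` (antitone `W` and `W_k ≤ 2c_B · m_k`)
  have hck : ∀ k, k ≤ 4 * 20 ^ m → c ≤ rotChi k := by
    intro k hk
    have ha : rotTriW (4 * 20 ^ m) ≤ rotTriW k := rotTriW_antitone hk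
    have hb := rotTriW_le_chi k
    rw [hc, div_le_iff₀ hcB2]
    linarith
  -- per block `20^i`: the tour
  have main : ∀ i ∈ range (m + 1), hexCriticalFugacity ^ 2 * c ^ 3 ≤ rotBotWin (20 ^ i) H H := by
    intro i hi
    have him : i ≤ m := Nat.lt_succ_iff.mp (mem_range.mp hi)
    have hpow : 20 ^ i ≤ 20 ^ m := Nat.pow_le_pow_right (by norm_num) him
    have hM : 1 ≤ 20 ^ i := Nat.one_le_pow i 20 (by norm_num)
    have hHM : 28 * 20 ^ i ≤ H := by rw [hH]; exact Nat.mul_le_mul_left 28 hpow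
    have key := rotTourKeyIneq_holds (20 ^ i) H H hM hHM hHM c c hc0 hc0
      (fun k hk => hck k (by omega)) (fun k hk => hck k (by omega))
    have hchi : c ≤ rotChi (20 ^ i) := hck (20 ^ i) (by omega)
    have hx2 : 0 ≤ hexCriticalFugacity ^ 2 := by positivity
    calc hexCriticalFugacity ^ 2 * c ^ 3 = hexCriticalFugacity ^ 2 * c * c * c := by ring
      _ ≤ hexCriticalFugacity ^ 2 * rotChi (20 ^ i) * c * c := by
          nlinarith [mul_nonneg (sub_nonneg.2 hchi) (mul_nonneg (mul_nonneg hx2 hc0) hc0)]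
      _ ≤ rotBotWin (20 ^ i) H H := key
  have hsum : ((m : ℝ) + 1) * (hexCriticalFugacity ^ 2 * c ^ 3) ≤
      ∑ i ∈ range (m + 1), rotBotWin (20 ^ i) H H := by
    have := sum_le_sum main
    simp only [sum_const, card_range, nsmul_eq_mul] at this
    push_cast at this
    linarith
  have htot : ((m : ℝ) + 1) * (hexCriticalFugacity ^ 2 * c ^ 3) ≤
      2 * hexCriticalFugacity * Real.cos (Real.pi / 16) / (2 * Real.sin (Real.pi / 16)) :=
    hsum.trans ((rotBotWin_sum_le m H H).trans (rotBot_le_K hH1 hH1))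
  -- algebra: `(m+1) W³ = ((m+1) x_c² c³) · (2c_B)³ / x_c²`
  have h4ne : (4 * Real.cos (Real.pi / 16)) ≠ 0 := hcB2.ne'
  have hxne : hexCriticalFugacity ≠ 0 := hx.ne'
  have hcosne : Real.cos (Real.pi / 16) ≠ 0 := hcB.ne'
  have e : ((m : ℝ) + 1) * rotTriW (4 * 20 ^ m) ^ 3 =
      ((m : ℝ) + 1) * (hexCriticalFugacity ^ 2 * c ^ 3) *
        ((4 * Real.cos (Real.pi / 16)) ^ 3 / hexCriticalFugacity ^ 2) := by
    rw [hc]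
    field_simp
  have hfac : 0 ≤ (4 * Real.cos (Real.pi / 16)) ^ 3 / hexCriticalFugacity ^ 2 :=
    div_nonneg (pow_nonneg hcB2.le 3) (pow_nonneg hx.le 2)
  rw [e]
  calc ((m : ℝ) + 1) * (hexCriticalFugacity ^ 2 * c ^ 3) *
        ((4 * Real.cos (Real.pi / 16)) ^ 3 / hexCriticalFugacity ^ 2)
      ≤ 2 * hexCriticalFugacity * Real.cos (Real.pi / 16) / (2 * Real.sin (Real.pi / 16)) *
        ((4 * Real.cos (Real.pi / 16)) ^ 3 / hexCriticalFugacity ^ 2) :=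
        mul_le_mul_of_nonneg_right htot hfac
    _ = _ := by ring

/-- the constant in closed form: `A₀ = 64 cos⁴(π/16)/(x_c sin(π/16))` (`= 560.9…`). [cite: GlazmanManolescu2019, §4.1 (proof of Proposition 1.1)] -/
theorem rotTriBlockConst_eq :
    2 * hexCriticalFugacity * Real.cos (Real.pi / 16) / (2 * Real.sin (Real.pi / 16)) *
        (4 * Real.cos (Real.pi / 16)) ^ 3 / hexCriticalFugacity ^ 2 =
      64 * Real.cos (Real.pi / 16) ^ 4 / (hexCriticalFugacity * Real.sin (Real.pi / 16)) := by
  have hxne : hexCriticalFugacity ≠ 0 := hexCriticalFugacity_pos_lt_one.1.ne'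
  have hsne : Real.sin (Real.pi / 16) ≠ 0 := sin16_pos.ne'
  field_simp
  ring

/-- **numeral: `A₀ ≤ 562`** (`x_c > 0.54119`, `cos(π/16) < 0.98079`, `sin(π/16) > 0.195`). [cite: GlazmanManolescu2019, §4.1 (proof of Proposition 1.1); DuminilCopinSmirnov2012, Theorem 1] -/
theorem rotTriBlockConst_le :
    2 * hexCriticalFugacity * Real.cos (Real.pi / 16) / (2 * Real.sin (Real.pi / 16)) *
        (4 * Real.cos (Real.pi / 16)) ^ 3 / hexCriticalFugacity ^ 2 ≤ 562 := by
  have hx : 0 < hexCriticalFugacity := hexCriticalFugacity_pos_lt_one.1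
  rw [rotTriBlockConst_eq, div_le_iff₀ (mul_pos hx sin16_pos)]
  have hc4 : Real.cos (Real.pi / 16) ^ 4 ≤ 0.98079 ^ 4 := pow_le_pow_left₀ cos16_pos.le cos16_lt.le 4
  have hxs : (0.54119 : ℝ) * 0.195 ≤ hexCriticalFugacity * Real.sin (Real.pi / 16) :=
    mul_le_mul xc_bounds.1.le sin16_gt.le (by norm_num) hx.le
  nlinarith

/-- **T1, numeral form: `(m+1) · W_{4·20^m}³ ≤ 562`** for every `m`. [cite: GlazmanManolescu2019, §4.1 (proof of Proposition 1.1); Beaton2014RotatedHoneycomb, Proposition 4] -/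
theorem rotTriBlockIneq_numeral (m : ℕ) : ((m : ℝ) + 1) * rotTriW (4 * 20 ^ m) ^ 3 ≤ 562 :=
  (rotTriBlockIneq_explicit m).trans rotTriBlockConst_le

/-! ## §2 (T2) The triangle functional decays with an explicit constant -/

/-- **T2 — `W_N ≤ C₁ · (log N)^{-1/3}` with `C₁ = max(2x_c cos(π/16) · (log 6400)^{1/3}, (2 A₀ log 20)^{1/3})`**
(`N ≥ 2`): the tree's abstract tail `SAW.antitone_le_log_rpow_of_blocks` (`a = 4`, `b = 0`, `q = 20`) fed with T1, the
antitonicity `rotTriW_antitone` and the uniform bound `rotTriW_le`; the tree's `rotTriW_le_log` is the existential form.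
[cite: GlazmanManolescu2019, §4.1 (proof of Proposition 1.1; all-T form = tree THM A `HexSAWBridgeLogDecay`)] -/
theorem rotTriW_le_log_explicit {N : ℕ} (hN : 2 ≤ N) :
    rotTriW N ≤ max (2 * hexCriticalFugacity * Real.cos (Real.pi / 16) * Real.log 6400 ^ ((1 : ℝ) / 3))
        ((2 * (2 * hexCriticalFugacity * Real.cos (Real.pi / 16) / (2 * Real.sin (Real.pi / 16)) *
          (4 * Real.cos (Real.pi / 16)) ^ 3 / hexCriticalFugacity ^ 2) * Real.log 20) ^ ((1 : ℝ) / 3)) *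
      Real.log N ^ (-(1 : ℝ) / 3) := by
  have hblock : ∀ m : ℕ, ((m : ℝ) + 1) * rotTriW (4 * 20 ^ m + 0) ^ 3 ≤
      2 * hexCriticalFugacity * Real.cos (Real.pi / 16) / (2 * Real.sin (Real.pi / 16)) *
        (4 * Real.cos (Real.pi / 16)) ^ 3 / hexCriticalFugacity ^ 2 := fun m => by
    simpa only [add_zero] using rotTriBlockIneq_explicit m
  have h := antitone_le_log_rpow_of_blocks rotTriW_antitone rotTriW_nonneg (fun M => (rotTriW_le M).2)
    (a := 4) (b := 0) (q := 20) (by norm_num) (by norm_num) rotTriBlockConst_nonneg hblock N hN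
  have hcast : ((((4 + 0) * 20) ^ 2 : ℕ) : ℝ) = 6400 := by norm_num
  rw [hcast] at h
  exact h

/-- **T2, numeral form: `W_N ≤ 15 · (log N)^{-1/3}`** for `N ≥ 2` (`2x_c cos(π/16) ≤ 1.0617`, `(log 6400)^{1/3} ≤ 2.0801`,
`(2 · 562 · 3)^{1/3} ≤ 15`). [cite: GlazmanManolescu2019, §4.1 (proof of Proposition 1.1)] -/
theorem rotTriW_le_fifteen_mul_log {N : ℕ} (hN : 2 ≤ N) : rotTriW N ≤ 15 * Real.log N ^ (-(1 : ℝ) / 3) := by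
  have h := rotTriW_le_log_explicit hN
  have hN1 : (1 : ℝ) < N := by exact_mod_cast (by omega : 1 < N)
  have hy0 : 0 ≤ Real.log N ^ (-(1 : ℝ) / 3) := Real.rpow_nonneg (Real.log_pos hN1).le _
  refine h.trans (mul_le_mul_of_nonneg_right (max_le ?_ ?_) hy0)
  · have hl0 : 0 ≤ Real.log 6400 := Real.log_nonneg (by norm_num)
    have h1 : Real.log 6400 ^ ((1 : ℝ) / 3) ≤ 2.0801 :=
      rpow_third_le hl0 (by norm_num) (log_6400_le.trans (by norm_num))
    have h3 : 0 ≤ Real.log 6400 ^ ((1 : ℝ) / 3) := Real.rpow_nonneg hl0 _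
    calc 2 * hexCriticalFugacity * Real.cos (Real.pi / 16) * Real.log 6400 ^ ((1 : ℝ) / 3)
        ≤ 1.0617 * 2.0801 := mul_le_mul wmax_le h1 h3 (by norm_num)
      _ ≤ 15 := by norm_num
  · have hA := rotTriBlockConst_le
    have hA0 := rotTriBlockConst_nonneg
    have hl := log_twenty_le
    have hl0 : 0 ≤ Real.log 20 := Real.log_nonneg (by norm_num)
    refine rpow_third_le (mul_nonneg (mul_nonneg zero_le_two hA0) hl0) (by norm_num) ?_
    calc 2 * (2 * hexCriticalFugacity * Real.cos (Real.pi / 16) / (2 * Real.sin (Real.pi / 16)) *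
          (4 * Real.cos (Real.pi / 16)) ^ 3 / hexCriticalFugacity ^ 2) * Real.log 20 ≤ 2 * 562 * 3 := by
          nlinarith [mul_le_mul hA hl hl0 (by norm_num : (0:ℝ) ≤ 562)]
      _ ≤ 15 ^ 3 := by norm_num

/-! ## §3 (T3) THM A with an explicit constant -/

/-- **T3 — THM A WITH AN EXPLICIT CONSTANT: `B^{⊥,→}_{D(H,W)}(x_c) ≤ 21 · (log H)^{-1/3}` for all `H ≥ 2` and all
widths `W`** (the tree's `rotStripLogDecay_holds` is `∃ C`). `H < 64`: Beaton's uniform bound `≤ 2x_c cos(π/16) ≤ 1.0617`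
and `(log 64)^{1/3} ≤ 1.61`; `H ≥ 64`: `M = ⌊(H−2)/6⌋ ≥ 10`, `B ≤ W_M ≤ 15 (log M)^{-1/3}`, `log M ≥ ½ log H`,
`15 · 2^{1/3} ≤ 18.9 ≤ 21`.  Beaton 2014 App. Thm 14 prints `B_T(x_c) → 0` without a rate; the rate is Glazman–Manolescu's
argument transported to the rotated frame (tree door R95); the constant is this file's.
[cite: GlazmanManolescu2019, Proposition 1.1 and §4.1; Beaton2014RotatedHoneycomb, Proposition 4 and Appendix Theorem 14 (arXiv v3 p. 19)] -/
theorem rotStripBR_le_twentyone_mul_log {H : ℕ} (hH : 2 ≤ H) (Wd : ℕ) :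
    rotStripBR H Wd ≤ 21 * Real.log H ^ (-(1 : ℝ) / 3) := by
  have hlog64 : 0 < Real.log 64 := Real.log_pos (by norm_num)
  have hH1 : (1 : ℝ) < H := by exact_mod_cast (by omega : 1 < H)
  have hlogH : 0 < Real.log H := Real.log_pos hH1
  have hy0 : 0 ≤ Real.log H ^ (-(1 : ℝ) / 3) := Real.rpow_nonneg hlogH.le _
  rcases Nat.lt_or_ge H 64 with hH64 | hH64
  · have hle : Real.log H ≤ Real.log 64 :=
      Real.log_le_log (by positivity) (by exact_mod_cast (by omega : H ≤ 64))
    have hmono : Real.log 64 ^ (-(1 : ℝ) / 3) ≤ Real.log H ^ (-(1 : ℝ) / 3) :=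
      Real.rpow_le_rpow_of_nonpos hlogH hle (by norm_num)
    have hone : Real.log 64 ^ ((1 : ℝ) / 3) * Real.log 64 ^ (-(1 : ℝ) / 3) = 1 := by
      rw [← Real.rpow_add hlog64]; norm_num
    have hcr : Real.log 64 ^ ((1 : ℝ) / 3) ≤ 1.61 :=
      rpow_third_le hlog64.le (by norm_num) (log_64_le.trans (by norm_num))
    have ht0 : 0 ≤ Real.log 64 ^ (-(1 : ℝ) / 3) := Real.rpow_nonneg hlog64.le _
    have h1 : (1 : ℝ) ≤ 1.61 * Real.log 64 ^ (-(1 : ℝ) / 3) := by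
      calc (1 : ℝ) = Real.log 64 ^ ((1 : ℝ) / 3) * Real.log 64 ^ (-(1 : ℝ) / 3) := hone.symm
        _ ≤ 1.61 * Real.log 64 ^ (-(1 : ℝ) / 3) := mul_le_mul_of_nonneg_right hcr ht0
    have h21 := mul_le_mul_of_nonneg_left hmono (by norm_num : (0 : ℝ) ≤ 21)
    calc rotStripBR H Wd ≤ 2 * hexCriticalFugacity * Real.cos (Real.pi / 16) := rotStripBR_le_K (by omega) Wd
      _ ≤ 1.0617 := wmax_le
      _ ≤ 21 * Real.log 64 ^ (-(1 : ℝ) / 3) := by linarith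
      _ ≤ 21 * Real.log H ^ (-(1 : ℝ) / 3) := h21
  · obtain ⟨M, hM⟩ : ∃ M : ℕ, M = (H - 2) / 6 := ⟨_, rfl⟩
    have hM10 : 10 ≤ M := by omega
    have hMH : 6 * M + 2 ≤ H := by omega
    have hHM : H < 6 * M + 8 := by omega
    have hMM : H < M * M := by nlinarith [Nat.mul_le_mul_right M hM10]
    have hcmp : rotStripBR H Wd ≤ rotTriW M := rotStripBR_le_rotTriW_all hMH Wd
    have hWM : rotTriW M ≤ 15 * Real.log M ^ (-(1 : ℝ) / 3) := rotTriW_le_fifteen_mul_log (by omega)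
    have hM1 : (1 : ℝ) < M := by exact_mod_cast (by omega : 1 < M)
    have hlogM : 0 < Real.log M := Real.log_pos hM1
    have hlogHM : Real.log H ≤ 2 * Real.log M := by
      have h0 : H ≤ M ^ 2 := by rw [sq]; exact hMM.le
      have h1 : (H : ℝ) ≤ (M : ℝ) ^ 2 := by exact_mod_cast h0
      have h2 := Real.log_le_log (by positivity) h1
      rw [Real.log_pow] at h2
      push_cast at h2
      linarith
    have hhalf : Real.log H / 2 ≤ Real.log M := by linarith
    have hmono : Real.log M ^ (-(1 : ℝ) / 3) ≤ (Real.log H / 2) ^ (-(1 : ℝ) / 3) :=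
      Real.rpow_le_rpow_of_nonpos (half_pos hlogH) hhalf (by norm_num)
    have hsplit : (Real.log H / 2) ^ (-(1 : ℝ) / 3) =
        (2 : ℝ) ^ ((1 : ℝ) / 3) * Real.log H ^ (-(1 : ℝ) / 3) := by
      rw [Real.div_rpow hlogH.le zero_le_two, div_eq_mul_inv, ← Real.rpow_neg zero_le_two]
      norm_num
      ring
    rw [hsplit] at hmono
    have h2r : (2 : ℝ) ^ ((1 : ℝ) / 3) ≤ 1.26 := rpow_third_le zero_le_two (by norm_num) (by norm_num)
    calc rotStripBR H Wd ≤ 15 * Real.log M ^ (-(1 : ℝ) / 3) := hcmp.trans hWM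
      _ ≤ 15 * ((2 : ℝ) ^ ((1 : ℝ) / 3) * Real.log H ^ (-(1 : ℝ) / 3)) :=
          mul_le_mul_of_nonneg_left hmono (by norm_num)
      _ ≤ 15 * (1.26 * Real.log H ^ (-(1 : ℝ) / 3)) :=
          mul_le_mul_of_nonneg_left (mul_le_mul_of_nonneg_right h2r hy0) (by norm_num)
      _ ≤ 21 * Real.log H ^ (-(1 : ℝ) / 3) := by nlinarith

/-- **T3 on Beaton's infinite-strip object: `B_H(x_c) = ⨆_W B^{⊥,→}_{D(H,W)}(x_c) ≤ 21 · (log H)^{-1/3}`** for `H ≥ 2`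
(the tree's `iSup_rotStripBR_le_log` is `∃ C`; `B_H = lim_W = ⨆_W` by the tree's `tendsto_rotStripBR`).
[cite: Beaton2014RotatedHoneycomb, §4 (B_T = lim_L B_{T,L}) and Appendix Theorem 14; GlazmanManolescu2019, Proposition 1.1] -/
theorem iSup_rotStripBR_le_twentyone_mul_log {H : ℕ} (hH : 2 ≤ H) :
    (⨆ Wd : ℕ, rotStripBR H Wd) ≤ 21 * Real.log H ^ (-(1 : ℝ) / 3) :=
  ciSup_le fun Wd => rotStripBR_le_twentyone_mul_log hH Wd

/-- the explicit constant instantiates the tree's existential face `RotStripLogDecay` (sanity link; an `example`, the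
tree's `rotStripLogDecay_holds` being the theorem of record). [cite: GlazmanManolescu2019, Proposition 1.1] -/
example : RotStripLogDecay :=
  ⟨21, fun _ hH Wd => rotStripBR_le_twentyone_mul_log hH Wd⟩

/-- `x_c⁻¹ · 21 ≤ 39` (`x_c > 0.54119`). [cite: DuminilCopinSmirnov2012, Theorem 1] -/
theorem inv_hexCriticalFugacity_mul_twentyone_le : hexCriticalFugacity⁻¹ * 21 ≤ 39 := by
  have hx : 0 < hexCriticalFugacity := hexCriticalFugacity_pos_lt_one.1
  rw [inv_mul_le_iff₀ hx]
  nlinarith [xc_bounds.1]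

end HV

/-! ## §4 (T4) Beaton's Appendix Theorem 14 object with an explicit constant -/

namespace HexBW

open Literature.Probability.LatticeModels

/-- **T4 — the brick-wall SPAN generating functions at criticality decay with an explicit constant:
`v_A = Σ_m #spanBridges(m, A) · μ_ℍ^{-m} ≤ 39 · (log A)^{-1/3}` for `A ≥ 2`** (the tree's `spanDecayLog_holds` is `∃ C`;
Beaton 2014 Appendix Theorem 14 prints `PP_T(x_c) → 0` without a rate). Every partial sum is `≤ x_c⁻¹ · B^{⊥,→}_{D(A,N)}(x_c)`
by the tree's dictionary `rot_dictionary`, T3 bounds that by `x_c⁻¹ · 21 (log A)^{-1/3} ≤ 39 (log A)^{-1/3}`, and a `tsum`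
of a nonnegative series is bounded by a bound on its partial sums.
[cite: Beaton2014RotatedHoneycomb, §2 and Appendix Theorem 14 (arXiv v3 p. 19); GlazmanManolescu2019, Proposition 1.1] -/
theorem bwSpanV_le_thirtynine_mul_log {A : ℕ} (hA : 2 ≤ A) :
    bwSpanV A ≤ 39 * Real.log A ^ (-(1 : ℝ) / 3) := by
  have hx : 0 < hexCriticalFugacity := hexCriticalFugacity_pos_lt_one.1
  have hx0 : 0 ≤ hexCriticalFugacity⁻¹ := inv_nonneg.2 hx.le
  have hA1 : (1 : ℝ) < A := by exact_mod_cast (by omega : 1 < A)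
  have hr0 : 0 ≤ Real.log A ^ (-(1 : ℝ) / 3) := Real.rpow_nonneg (Real.log_pos hA1).le _
  have hinv := HV.inv_hexCriticalFugacity_mul_twentyone_le
  have hpart : ∀ N : ℕ, ∑ m ∈ range N, bwSpanTerm A m ≤ 39 * Real.log A ^ (-(1 : ℝ) / 3) := fun N =>
    calc ∑ m ∈ range N, bwSpanTerm A m
        = ∑ m ∈ range N, (#(brSpan m (A : ℤ)) : ℝ) / hexConnectiveConstant ^ m := rfl
      _ ≤ hexCriticalFugacity⁻¹ * HV.rotStripBR A N := rot_dictionary A N (by omega)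
      _ ≤ hexCriticalFugacity⁻¹ * (21 * Real.log A ^ (-(1 : ℝ) / 3)) :=
          mul_le_mul_of_nonneg_left (HV.rotStripBR_le_twentyone_mul_log hA N) hx0
      _ = hexCriticalFugacity⁻¹ * 21 * Real.log A ^ (-(1 : ℝ) / 3) := by ring
      _ ≤ 39 * Real.log A ^ (-(1 : ℝ) / 3) := mul_le_mul_of_nonneg_right hinv hr0
  exact Real.tsum_le_of_sum_range_le (bwSpanTerm_nonneg A) hpart

/-- the explicit constant instantiates the tree's existential face `SpanDecayLog` (sanity link; an `example`, the tree's
`spanDecayLog_holds` being the theorem of record). [cite: Beaton2014RotatedHoneycomb, Appendix Theorem 14] -/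
example : SpanDecayLog :=
  ⟨39, fun _ hA => bwSpanV_le_thirtynine_mul_log hA⟩

end HexBW

end Literature.Probability.RandomPlanarGeometry.SAW
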